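import Mathlib
import Summits.AtomisticToContinuum.FouriersLaw.Theorems.EmbeddedDrudeMourreDrudeDissolutionCellSecondDifference
import Summits.AtomisticToContinuum.FouriersLaw.Theorems.EmbeddedDrudeMourreDrudeDissolutionFluxPointwise
import HarnessLib

/-!
# The gradient flux of a cut-off amplitude: regularity, periodicity and the engine call
(crux `EmbeddedDrudeMourre.DrudeDissolution`, item stmt-AtomisticToContinuum-12593; `--supports` file for the
registered sub-goal `cell_secondDiff_le_gradFlux` of stub B1b″ `stub_excursionSecondDifference` of line
`kinetic-polymer-gas-on-the-time-axis`; closes nothing; lead c13 (process B), 2026-08-17)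

WHAT. On `ℝ³` with the coordinate frame, let `Ω ∈ C³` and `G ∈ C²` be `2π`-periodic in each coordinate,
`D = Σ(∂ᵢΩ)²`, `Xᵢ = ∂ᵢΩ/D`, and suppose the amplitude VANISHES NEAR THE CRITICAL SET:
`D p = 0 ⇒ G = 0` on a neighbourhood of `p`. Then the level-one flux `Yᵢ = G·Xᵢ` is `C²` and periodic
with `ΣYᵢ∂ᵢΩ = G` everywhere, its divergence `LG = Σ∂ᵢ(G·Xᵢ)` is `C¹`, periodic and vanishes near the
critical set, the level-two flux `Y'ᵢ = −(LG)·Xᵢ` is `C¹`, periodic with `ΣY'ᵢ∂ᵢΩ = −Σ∂ᵢYᵢ`; feeding the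
`O(δ²)` engine `cell_abs_integral_secondDiff_le`:
`|∫_cell G·(2φ(Ω) − φ(Ω+δ) − φ(Ω−δ))| ≤ δ²·∫_cell |Σᵢ∂ᵢ((LG)·Xᵢ)|`     (`cell_secondDiff_le_gradFlux`).

WHY (role). This is the flux-side glue of the sup-norm route: it reduces the cube form of B1b″ for the
cut-off amplitude `G = W·Θ_η` to a SUP BOUND of the pointwise quantity `Σᵢ∂ᵢ((LG)Xᵢ)` — which
`flux_pointwise_bound` controls by `η⁻²` — plus the discarded tube mass.
-/

noncomputable section

open Set Filter Function Topology MeasureTheory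
open scoped Topology

namespace Summit.AtomisticToContinuum.FouriersLaw.Theorems.DrudeDissolution.KineticPolymerGasOnTheTimeAxis

/-! ### §1 Periodicity of derivatives -/

/-- The derivative of a function invariant under a translation is invariant under it. [folklore] -/
theorem fderiv_periodic {V : Type*} [NormedAddCommGroup V] [NormedSpace ℝ V] {F : V → ℝ} {T : V}
    (hF : ∀ q, F (q + T) = F q) (p : V) : fderiv ℝ F (p + T) = fderiv ℝ F p := by
  have hfun : (fun x => F (x + T)) = F := funext hF
  rw [← fderiv_comp_add_right, hfun]

/-- Coordinate form, first coordinate. [folklore] -/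
theorem fderiv_periodic₁ {F : ℝ × ℝ × ℝ → ℝ} (hF : ∀ p : ℝ × ℝ × ℝ, F (p.1 + 2 * Real.pi, p.2.1, p.2.2) = F p)
    (p : ℝ × ℝ × ℝ) (v : ℝ × ℝ × ℝ) :
    fderiv ℝ F (p.1 + 2 * Real.pi, p.2.1, p.2.2) v = fderiv ℝ F p v := by
  have hT : ∀ q : ℝ × ℝ × ℝ, F (q + ((2 * Real.pi, 0, 0) : ℝ × ℝ × ℝ)) = F q := fun q => by
    have := hF q; simpa [Prod.add_def] using this
  have := fderiv_periodic hT p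
  rw [show ((p.1 + 2 * Real.pi, p.2.1, p.2.2) : ℝ × ℝ × ℝ) = p + ((2 * Real.pi, 0, 0) : ℝ × ℝ × ℝ) by
    simp [Prod.add_def], this]

/-- Coordinate form, middle coordinate. [folklore] -/
theorem fderiv_periodic₂ {F : ℝ × ℝ × ℝ → ℝ} (hF : ∀ p : ℝ × ℝ × ℝ, F (p.1, p.2.1 + 2 * Real.pi, p.2.2) = F p)
    (p : ℝ × ℝ × ℝ) (v : ℝ × ℝ × ℝ) :
    fderiv ℝ F (p.1, p.2.1 + 2 * Real.pi, p.2.2) v = fderiv ℝ F p v := by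
  have hT : ∀ q : ℝ × ℝ × ℝ, F (q + ((0, 2 * Real.pi, 0) : ℝ × ℝ × ℝ)) = F q := fun q => by
    have := hF q; simpa [Prod.add_def] using this
  have := fderiv_periodic hT p
  rw [show ((p.1, p.2.1 + 2 * Real.pi, p.2.2) : ℝ × ℝ × ℝ) = p + ((0, 2 * Real.pi, 0) : ℝ × ℝ × ℝ) by
    simp [Prod.add_def], this]

/-- Coordinate form, last coordinate. [folklore] -/
theorem fderiv_periodic₃ {F : ℝ × ℝ × ℝ → ℝ} (hF : ∀ p : ℝ × ℝ × ℝ, F (p.1, p.2.1, p.2.2 + 2 * Real.pi) = F p)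
    (p : ℝ × ℝ × ℝ) (v : ℝ × ℝ × ℝ) :
    fderiv ℝ F (p.1, p.2.1, p.2.2 + 2 * Real.pi) v = fderiv ℝ F p v := by
  have hT : ∀ q : ℝ × ℝ × ℝ, F (q + ((0, 0, 2 * Real.pi) : ℝ × ℝ × ℝ)) = F q := fun q => by
    have := hF q; simpa [Prod.add_def] using this
  have := fderiv_periodic hT p
  rw [show ((p.1, p.2.1, p.2.2 + 2 * Real.pi) : ℝ × ℝ × ℝ) = p + ((0, 0, 2 * Real.pi) : ℝ × ℝ × ℝ) by
    simp [Prod.add_def], this]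

/-! ### §2 Functions vanishing near a point -/

/-- If `F = 0` near `p` then `∂F = 0` near `p`. [folklore] -/
theorem fderiv_eventuallyEq_zero {V : Type*} [NormedAddCommGroup V] [NormedSpace ℝ V] {F : V → ℝ}
    {p : V} (h : F =ᶠ[𝓝 p] 0) (v : V) : (fun q => fderiv ℝ F q v) =ᶠ[𝓝 p] 0 := by
  filter_upwards [h.eventually_nhds] with q hq
  have hq' : F =ᶠ[𝓝 q] fun _ => (0 : ℝ) := hq
  rw [hq'.fderiv_eq]
  simp

/-! ### §3 The gradient flux of an amplitude vanishing near the critical set -/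

section Glue

variable {Ω G D X₁ X₂ X₃ : ℝ × ℝ × ℝ → ℝ}

/-- `D = Σ(∂ᵢΩ)²` is `C²` for `Ω ∈ C³`. [folklore] -/
theorem glue_contDiff_D (hΩ : ContDiff ℝ 3 Ω)
    (hD : ∀ q, D q = (fderiv ℝ Ω q (1, 0, 0)) ^ 2 + (fderiv ℝ Ω q (0, 1, 0)) ^ 2 + (fderiv ℝ Ω q (0, 0, 1)) ^ 2) :
    ContDiff ℝ 2 D := by
  have hd : ∀ v : ℝ × ℝ × ℝ, ContDiff ℝ 2 fun q => fderiv ℝ Ω q v := fun v =>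
    (hΩ.fderiv_right (m := 2) (by norm_num)).clm_apply contDiff_const
  have : D = fun q => (fderiv ℝ Ω q (1, 0, 0)) ^ 2 + (fderiv ℝ Ω q (0, 1, 0)) ^ 2 +
      (fderiv ℝ Ω q (0, 0, 1)) ^ 2 := funext hD
  rw [this]
  exact (((hd _).pow 2).add ((hd _).pow 2)).add ((hd _).pow 2)

/-- `D p = 0` forces all three partial derivatives to vanish at `p`. [folklore] -/
theorem glue_fderiv_eq_zero_of_D
    (hD : ∀ q, D q = (fderiv ℝ Ω q (1, 0, 0)) ^ 2 + (fderiv ℝ Ω q (0, 1, 0)) ^ 2 + (fderiv ℝ Ω q (0, 0, 1)) ^ 2)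
    {p : ℝ × ℝ × ℝ} (hp : D p = 0) :
    fderiv ℝ Ω p (1, 0, 0) = 0 ∧ fderiv ℝ Ω p (0, 1, 0) = 0 ∧ fderiv ℝ Ω p (0, 0, 1) = 0 := by
  rw [hD] at hp
  have h1 := sq_nonneg (fderiv ℝ Ω p (1, 0, 0))
  have h2 := sq_nonneg (fderiv ℝ Ω p (0, 1, 0))
  have h3 := sq_nonneg (fderiv ℝ Ω p (0, 0, 1))
  exact ⟨(pow_eq_zero_iff two_ne_zero).1 (by linarith), (pow_eq_zero_iff two_ne_zero).1 (by linarith),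
    (pow_eq_zero_iff two_ne_zero).1 (by linarith)⟩

/-- **The product `G·X` is `C²`** when `G ∈ C²` vanishes near `{D = 0}` and `X = u/D` with `u ∈ C²`.
[folklore] -/
theorem glue_contDiff_mul_quot (hΩ : ContDiff ℝ 3 Ω)
    (hD : ∀ q, D q = (fderiv ℝ Ω q (1, 0, 0)) ^ 2 + (fderiv ℝ Ω q (0, 1, 0)) ^ 2 + (fderiv ℝ Ω q (0, 0, 1)) ^ 2)
    {X : ℝ × ℝ × ℝ → ℝ} {v : ℝ × ℝ × ℝ} (hX : ∀ q, X q = fderiv ℝ Ω q v / D q)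
    {F : ℝ × ℝ × ℝ → ℝ} {n : ℕ} (hn : n ≤ 2) (hF : ContDiff ℝ n F)
    (hvan : ∀ p, D p = 0 → F =ᶠ[𝓝 p] 0) :
    ContDiff ℝ n fun q => F q * X q := by
  have hDc : ContDiff ℝ 2 D := glue_contDiff_D hΩ hD
  have hu : ContDiff ℝ 2 fun q => fderiv ℝ Ω q v := (hΩ.fderiv_right (m := 2) (by norm_num)).clm_apply contDiff_const
  have hXfun : X = fun q => fderiv ℝ Ω q v / D q := funext hX
  rw [contDiff_iff_contDiffAt]
  intro p
  by_cases hp : D p = 0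
  · have h0 : (fun q => F q * X q) =ᶠ[𝓝 p] fun _ => (0 : ℝ) := by
      filter_upwards [hvan p hp] with q hq
      simp [hq]
    exact (contDiffAt_const (c := (0 : ℝ))).congr_of_eventuallyEq h0
  · have hXp : ContDiffAt ℝ n X p := by
      rw [hXfun]
      exact (hu.contDiffAt.div hDc.contDiffAt hp).of_le (by exact_mod_cast hn)
    exact hF.contDiffAt.mul hXp

/-- **Flux identity** `G·X₁·∂₁Ω + G·X₂·∂₂Ω + G·X₃·∂₃Ω = G` everywhere (at critical points both sides
vanish). [folklore] -/
theorem glue_flux_identity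
    (hD : ∀ q, D q = (fderiv ℝ Ω q (1, 0, 0)) ^ 2 + (fderiv ℝ Ω q (0, 1, 0)) ^ 2 + (fderiv ℝ Ω q (0, 0, 1)) ^ 2)
    (hX₁ : ∀ q, X₁ q = fderiv ℝ Ω q (1, 0, 0) / D q) (hX₂ : ∀ q, X₂ q = fderiv ℝ Ω q (0, 1, 0) / D q)
    (hX₃ : ∀ q, X₃ q = fderiv ℝ Ω q (0, 0, 1) / D q) {F : ℝ × ℝ × ℝ → ℝ}
    (hvan : ∀ p, D p = 0 → F =ᶠ[𝓝 p] 0) (p : ℝ × ℝ × ℝ) :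
    F p * X₁ p * fderiv ℝ Ω p (1, 0, 0) + F p * X₂ p * fderiv ℝ Ω p (0, 1, 0) +
      F p * X₃ p * fderiv ℝ Ω p (0, 0, 1) = F p := by
  by_cases hp : D p = 0
  · have hF0 : F p = 0 := (hvan p hp).self_of_nhds
    simp [hF0]
  · rw [hX₁, hX₂, hX₃]
    have hDp := hD p
    have key : F p * (fderiv ℝ Ω p (1, 0, 0) / D p) * fderiv ℝ Ω p (1, 0, 0) +
        F p * (fderiv ℝ Ω p (0, 1, 0) / D p) * fderiv ℝ Ω p (0, 1, 0) +
        F p * (fderiv ℝ Ω p (0, 0, 1) / D p) * fderiv ℝ Ω p (0, 0, 1) =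
        F p * ((fderiv ℝ Ω p (1, 0, 0) ^ 2 + fderiv ℝ Ω p (0, 1, 0) ^ 2 + fderiv ℝ Ω p (0, 0, 1) ^ 2) / D p) := by
      field_simp
    rw [key, ← hDp, div_self hp, mul_one]

end Glue

/-! ### §4 The engine call -/

/-- **Second differences of the pushforward of a cut-off amplitude (registered sub-goal
`cell_secondDiff_le_gradFlux` of stub B1b″; all binders explicit).** On `ℝ³` let `Ω ∈ C³` and `G ∈ C²` be
`2π`-periodic in each coordinate, `D = Σ(∂ᵢΩ)²`, `Xᵢ = ∂ᵢΩ/D`,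
`LG = ∂₁(G X₁) + ∂₂(G X₂) + ∂₃(G X₃)` and suppose `D p = 0 ⇒ G = 0 near p`. Then for every continuous test
function `|φ| ≤ 1` and `δ ≥ 0`:
`|∫_cell G·(2φ(Ω) − φ(Ω+δ) − φ(Ω−δ))| ≤ δ²·∫_cell |∂₁((LG)X₁) + ∂₂((LG)X₂) + ∂₃((LG)X₃)|`.
[cite: HormanderALPDO1, Thm. 7.7.1] -/
theorem cell_secondDiff_le_gradFlux :
    ∀ (Ω G D X₁ X₂ X₃ LG : ℝ × ℝ × ℝ → ℝ) (φ : ℝ → ℝ) (δ : ℝ), ContDiff ℝ 3 Ω →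
      (∀ p : ℝ × ℝ × ℝ, Ω (p.1 + 2 * Real.pi, p.2.1, p.2.2) = Ω p) →
      (∀ p : ℝ × ℝ × ℝ, Ω (p.1, p.2.1 + 2 * Real.pi, p.2.2) = Ω p) →
      (∀ p : ℝ × ℝ × ℝ, Ω (p.1, p.2.1, p.2.2 + 2 * Real.pi) = Ω p) →
      ContDiff ℝ 2 G →
      (∀ p : ℝ × ℝ × ℝ, G (p.1 + 2 * Real.pi, p.2.1, p.2.2) = G p) →
      (∀ p : ℝ × ℝ × ℝ, G (p.1, p.2.1 + 2 * Real.pi, p.2.2) = G p) →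
      (∀ p : ℝ × ℝ × ℝ, G (p.1, p.2.1, p.2.2 + 2 * Real.pi) = G p) →
      (∀ q, D q = (fderiv ℝ Ω q (1, 0, 0)) ^ 2 + (fderiv ℝ Ω q (0, 1, 0)) ^ 2 + (fderiv ℝ Ω q (0, 0, 1)) ^ 2) →
      (∀ q, X₁ q = fderiv ℝ Ω q (1, 0, 0) / D q) → (∀ q, X₂ q = fderiv ℝ Ω q (0, 1, 0) / D q) →
      (∀ q, X₃ q = fderiv ℝ Ω q (0, 0, 1) / D q) →
      (∀ q, LG q = fderiv ℝ (fun r => G r * X₁ r) q (1, 0, 0) + fderiv ℝ (fun r => G r * X₂ r) q (0, 1, 0) +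
        fderiv ℝ (fun r => G r * X₃ r) q (0, 0, 1)) →
      (∀ p, D p = 0 → G =ᶠ[𝓝 p] 0) →
      Continuous φ → (∀ x, |φ x| ≤ 1) → 0 ≤ δ →
      |∫ p, G p * (2 * φ (Ω p) - φ (Ω p + δ) - φ (Ω p - δ))
          ∂((volume.restrict (Set.Ioc (-Real.pi) Real.pi)).prod
            ((volume.restrict (Set.Ioc (-Real.pi) Real.pi)).prod
              (volume.restrict (Set.Ioc (-Real.pi) Real.pi))))| ≤
        δ ^ 2 * ∫ p, |fderiv ℝ (fun q => LG q * X₁ q) p (1, 0, 0) + fderiv ℝ (fun q => LG q * X₂ q) p (0, 1, 0) +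
            fderiv ℝ (fun q => LG q * X₃ q) p (0, 0, 1)|
          ∂((volume.restrict (Set.Ioc (-Real.pi) Real.pi)).prod
            ((volume.restrict (Set.Ioc (-Real.pi) Real.pi)).prod
              (volume.restrict (Set.Ioc (-Real.pi) Real.pi)))) := by
  intro Ω G D X₁ X₂ X₃ LG φ δ hΩ hΩ₁ hΩ₂ hΩ₃ hG hG₁ hG₂ hG₃ hD hX₁ hX₂ hX₃ hLG hvan hφ hφ1 hδ
  -- level-one fluxes `Yᵢ = G Xᵢ`: `C²`
  have hY₁ : ContDiff ℝ 2 fun q => G q * X₁ q := glue_contDiff_mul_quot hΩ hD hX₁ le_rfl hG hvan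
  have hY₂ : ContDiff ℝ 2 fun q => G q * X₂ q := glue_contDiff_mul_quot hΩ hD hX₂ le_rfl hG hvan
  have hY₃ : ContDiff ℝ 2 fun q => G q * X₃ q := glue_contDiff_mul_quot hΩ hD hX₃ le_rfl hG hvan
  -- periodicity of `D`, `Xᵢ`
  have hD₁ : ∀ p : ℝ × ℝ × ℝ, D (p.1 + 2 * Real.pi, p.2.1, p.2.2) = D p := fun p => by
    simp only [hD, fderiv_periodic₁ hΩ₁]
  have hD₂ : ∀ p : ℝ × ℝ × ℝ, D (p.1, p.2.1 + 2 * Real.pi, p.2.2) = D p := fun p => by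
    simp only [hD, fderiv_periodic₂ hΩ₂]
  have hD₃ : ∀ p : ℝ × ℝ × ℝ, D (p.1, p.2.1, p.2.2 + 2 * Real.pi) = D p := fun p => by
    simp only [hD, fderiv_periodic₃ hΩ₃]
  have hXp : ∀ {X : ℝ × ℝ × ℝ → ℝ} {v : ℝ × ℝ × ℝ}, (∀ q, X q = fderiv ℝ Ω q v / D q) →
      (∀ p : ℝ × ℝ × ℝ, X (p.1 + 2 * Real.pi, p.2.1, p.2.2) = X p) ∧
      (∀ p : ℝ × ℝ × ℝ, X (p.1, p.2.1 + 2 * Real.pi, p.2.2) = X p) ∧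
      (∀ p : ℝ × ℝ × ℝ, X (p.1, p.2.1, p.2.2 + 2 * Real.pi) = X p) := fun hX =>
    ⟨fun p => by rw [hX, hX, fderiv_periodic₁ hΩ₁, hD₁],
      fun p => by rw [hX, hX, fderiv_periodic₂ hΩ₂, hD₂],
      fun p => by rw [hX, hX, fderiv_periodic₃ hΩ₃, hD₃]⟩
  obtain ⟨hX₁₁, hX₁₂, hX₁₃⟩ := hXp hX₁
  obtain ⟨hX₂₁, hX₂₂, hX₂₃⟩ := hXp hX₂
  obtain ⟨hX₃₁, hX₃₂, hX₃₃⟩ := hXp hX₃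
  -- periodicity of the level-one fluxes
  have hYp : ∀ {X : ℝ × ℝ × ℝ → ℝ}, (∀ p : ℝ × ℝ × ℝ, X (p.1 + 2 * Real.pi, p.2.1, p.2.2) = X p) →
      (∀ p : ℝ × ℝ × ℝ, X (p.1, p.2.1 + 2 * Real.pi, p.2.2) = X p) →
      (∀ p : ℝ × ℝ × ℝ, X (p.1, p.2.1, p.2.2 + 2 * Real.pi) = X p) →
      (∀ p : ℝ × ℝ × ℝ, (fun q => G q * X q) (p.1 + 2 * Real.pi, p.2.1, p.2.2) = (fun q => G q * X q) p) ∧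
      (∀ p : ℝ × ℝ × ℝ, (fun q => G q * X q) (p.1, p.2.1 + 2 * Real.pi, p.2.2) = (fun q => G q * X q) p) ∧
      (∀ p : ℝ × ℝ × ℝ, (fun q => G q * X q) (p.1, p.2.1, p.2.2 + 2 * Real.pi) = (fun q => G q * X q) p) :=
    fun h1 h2 h3 => ⟨fun p => by simp only [hG₁, h1], fun p => by simp only [hG₂, h2],
      fun p => by simp only [hG₃, h3]⟩
  obtain ⟨hY₁₁, hY₁₂, hY₁₃⟩ := hYp hX₁₁ hX₁₂ hX₁₃
  obtain ⟨hY₂₁, hY₂₂, hY₂₃⟩ := hYp hX₂₁ hX₂₂ hX₂₃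
  obtain ⟨hY₃₁, hY₃₂, hY₃₃⟩ := hYp hX₃₁ hX₃₂ hX₃₃
  -- `LG` is `C¹`, periodic, and vanishes near the critical set
  have hLfun : LG = fun q => fderiv ℝ (fun r => G r * X₁ r) q (1, 0, 0) + fderiv ℝ (fun r => G r * X₂ r) q (0, 1, 0) +
      fderiv ℝ (fun r => G r * X₃ r) q (0, 0, 1) := funext hLG
  have hdY : ∀ {Y : ℝ × ℝ × ℝ → ℝ} (v : ℝ × ℝ × ℝ), ContDiff ℝ 2 Y → ContDiff ℝ 1 fun q => fderiv ℝ Y q v :=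
    fun v hY => (hY.fderiv_right (m := 1) (by norm_num)).clm_apply contDiff_const
  have hLG1 : ContDiff ℝ 1 LG := by
    rw [hLfun]; exact ((hdY _ hY₁).add (hdY _ hY₂)).add (hdY _ hY₃)
  have hLGp₁ : ∀ p : ℝ × ℝ × ℝ, LG (p.1 + 2 * Real.pi, p.2.1, p.2.2) = LG p := fun p => by
    simp only [hLG, fderiv_periodic₁ (F := fun q => G q * X₁ q) hY₁₁,
      fderiv_periodic₁ (F := fun q => G q * X₂ q) hY₂₁, fderiv_periodic₁ (F := fun q => G q * X₃ q) hY₃₁]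
  have hLGp₂ : ∀ p : ℝ × ℝ × ℝ, LG (p.1, p.2.1 + 2 * Real.pi, p.2.2) = LG p := fun p => by
    simp only [hLG, fderiv_periodic₂ (F := fun q => G q * X₁ q) hY₁₂,
      fderiv_periodic₂ (F := fun q => G q * X₂ q) hY₂₂, fderiv_periodic₂ (F := fun q => G q * X₃ q) hY₃₂]
  have hLGp₃ : ∀ p : ℝ × ℝ × ℝ, LG (p.1, p.2.1, p.2.2 + 2 * Real.pi) = LG p := fun p => by
    simp only [hLG, fderiv_periodic₃ (F := fun q => G q * X₁ q) hY₁₃,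
      fderiv_periodic₃ (F := fun q => G q * X₂ q) hY₂₃, fderiv_periodic₃ (F := fun q => G q * X₃ q) hY₃₃]
  have hLvan : ∀ p, D p = 0 → (fun q => -LG q) =ᶠ[𝓝 p] 0 := by
    intro p hp
    have hY0 : ∀ {X : ℝ × ℝ × ℝ → ℝ}, (fun q => G q * X q) =ᶠ[𝓝 p] 0 := by
      intro X
      filter_upwards [hvan p hp] with q hq
      simp [hq]
    filter_upwards [fderiv_eventuallyEq_zero (hY0 (X := X₁)) (1, 0, 0),
      fderiv_eventuallyEq_zero (hY0 (X := X₂)) (0, 1, 0), fderiv_eventuallyEq_zero (hY0 (X := X₃)) (0, 0, 1)]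
      with q h1 h2 h3
    simp only [Pi.zero_apply] at h1 h2 h3
    simp [hLG, h1, h2, h3]
  -- level-two fluxes `Y'ᵢ = (−LG)·Xᵢ`: `C¹`, periodic
  have hnL : ContDiff ℝ 1 fun q => -LG q := hLG1.neg
  have hY'₁ : ContDiff ℝ 1 fun q => -LG q * X₁ q := glue_contDiff_mul_quot hΩ hD hX₁ (by norm_num) hnL hLvan
  have hY'₂ : ContDiff ℝ 1 fun q => -LG q * X₂ q := glue_contDiff_mul_quot hΩ hD hX₂ (by norm_num) hnL hLvan
  have hY'₃ : ContDiff ℝ 1 fun q => -LG q * X₃ q := glue_contDiff_mul_quot hΩ hD hX₃ (by norm_num) hnL hLvan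
  -- flux identities
  have hflux1 : ∀ p, (fun q => G q * X₁ q) p * fderiv ℝ Ω p (1, 0, 0) + (fun q => G q * X₂ q) p * fderiv ℝ Ω p (0, 1, 0) +
      (fun q => G q * X₃ q) p * fderiv ℝ Ω p (0, 0, 1) = G p := fun p =>
    glue_flux_identity hD hX₁ hX₂ hX₃ hvan p
  have hflux2 : ∀ p, (fun q => -LG q * X₁ q) p * fderiv ℝ Ω p (1, 0, 0) +
      (fun q => -LG q * X₂ q) p * fderiv ℝ Ω p (0, 1, 0) + (fun q => -LG q * X₃ q) p * fderiv ℝ Ω p (0, 0, 1) =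
      -(fderiv ℝ (fun q => G q * X₁ q) p (1, 0, 0) + fderiv ℝ (fun q => G q * X₂ q) p (0, 1, 0) +
        fderiv ℝ (fun q => G q * X₃ q) p (0, 0, 1)) := fun p => by
    rw [glue_flux_identity hD hX₁ hX₂ hX₃ hLvan p, hLG]
  -- the engine
  have hE := cell_abs_integral_secondDiff_le Ω G (fun q => G q * X₁ q) (fun q => G q * X₂ q)
    (fun q => G q * X₃ q) (fun q => -LG q * X₁ q) (fun q => -LG q * X₂ q) (fun q => -LG q * X₃ q) φ δ
    (hΩ.of_le (by norm_num)) hΩ₁ hΩ₂ hΩ₃ (hY₁.of_le (by norm_num)) (hY₂.of_le (by norm_num))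
    (hY₃.of_le (by norm_num)) hY₁₁ hY₁₂ hY₁₃ hY₂₁ hY₂₂ hY₂₃ hY₃₁ hY₃₂ hY₃₃ hY'₁ hY'₂ hY'₃
    (fun p => by simp only [hLGp₁, hX₁₁]) (fun p => by simp only [hLGp₂, hX₁₂])
    (fun p => by simp only [hLGp₃, hX₁₃]) (fun p => by simp only [hLGp₁, hX₂₁])
    (fun p => by simp only [hLGp₂, hX₂₂]) (fun p => by simp only [hLGp₃, hX₂₃])
    (fun p => by simp only [hLGp₁, hX₃₁]) (fun p => by simp only [hLGp₂, hX₃₂])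
    (fun p => by simp only [hLGp₃, hX₃₃]) hflux1 hflux2 hφ hφ1 hδ
  -- the right-hand side: `∂ᵢ((−LG)Xᵢ) = −∂ᵢ((LG)Xᵢ)`
  refine hE.trans (le_of_eq ?_)
  congr 1
  refine integral_congr_ae (Eventually.of_forall fun p => ?_)
  have hneg : ∀ (X : ℝ × ℝ × ℝ → ℝ) (v : ℝ × ℝ × ℝ), fderiv ℝ (fun q => -LG q * X q) p v =
      -fderiv ℝ (fun q => LG q * X q) p v := by
    intro X v
    have : (fun q => -LG q * X q) = fun q => -(LG q * X q) := funext fun q => by ring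
    rw [this, fderiv_fun_neg]
    rfl
  simp only [hneg]
  rw [← abs_neg]
  congr 1
  ring

end Summit.AtomisticToContinuum.FouriersLaw.Theorems.DrudeDissolution.KineticPolymerGasOnTheTimeAxis

end
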